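import Mathlib
import Summits.NavierStokesRegularity.NavierStokesRegularity.Theorems.TaoLadderRungThreeGappedFrontRobustComparison
import Summits.NavierStokesRegularity.NavierStokesRegularity.Theorems.TaoLadderRungThreeGappedFrontRobustStepTransfer
import HarnessLib

/-!
# `GappedFrontRobust`, the (step) clause: UNIFORM TIME-LIPSCHITZ BOUND for the deviation of two flows
  (the `hlip` input of `pseudoFlowOn_active_zone` / `bootstrap_family`; helper for item
  stmt-NavierStokesRegularity-20423 and its announced restatement K_B₂)

HONEST FRAMING: an elementary lemma about Tao-type MODEL lattice pseudo-flows (Tao 2016 §4 Lemma 4.1 (4.5),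
(4.8)) in the cell vocabulary `TaoCascade.PseudoFlowOn`. Nothing here concerns the Navier–Stokes equations;
nothing is asserted about any table.

* `quadTerm_zero_family` — the quadratic term of the zero family vanishes;
* `abs_quadTerm_le_of_uniform` — `|quadTerm(X)_{i,n}| ≤ 2 (∑|α_{··i·}|) (1+ε₀)^{5n/2} M²` from a uniform
  amplitude bound `M` (the crude bilinear bound against the zero family);
* `pseudoFlowOn_sub_lipschitz` — for a pseudo-flow `S` (motion defect `κ₁ ≥ 0`) and a defect-free flow
  `S'` with the uniform (4.5)-bounds `|S|, |S'|, √F ≤ M` on `[0, τ]`, the deviation `δ = S − S'` of mode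
  `(i, n)` is Lipschitz in time with the explicit constant
  `ℓ_n = 4 (∑|α_{··i·}|) (1+ε₀)^{5n/2} M² + κ₁ (1+ε₀)^{2n} M`.
-/

noncomputable section

-- the sub-problem namespace `Summit.NavierStokesRegularity.NavierStokesRegularity` repeats the summit name by design (D-0017)
set_option linter.dupNamespace false

namespace Summit.NavierStokesRegularity.NavierStokesRegularity.Theorems

open Set MeasureTheory intervalIntegral Literature.Analysis.FluidPDE Literature.Analysis.FluidPDE.TaoCascade

namespace GappedFrontRobust

variable {m : ℕ}

/-- The quadratic term of the identically-zero family vanishes. [cite: Tao2016AveragedNS, §4 (4.8)] -/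
theorem quadTerm_zero_family (ε₀ : ℝ) (α : Fin m → Fin m → Fin m → ℤ × ℤ × ℤ → ℝ) (i : Fin m)
    (n : ℤ) (t : ℝ) : quadTerm ε₀ α (fun _ _ _ => (0 : ℝ)) i n t = 0 := by
  simp [quadTerm]

/-- **Crude size of the quadratic term from a uniform amplitude bound** (`ε₀ ≥ 0`): if
`|X_{j,k}(t)| ≤ M` for all modes and shells then `|quadTerm(X)_{i,n}(t)| ≤ 2 (∑_{i₁,i₂,μ}|α_{i₁i₂iμ}|) (1+ε₀)^{5n/2} M²`.
[cite: Tao2016AveragedNS, §4 (4.8)] -/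
theorem abs_quadTerm_le_of_uniform {ε₀ : ℝ} (hε : 0 ≤ ε₀)
    (α : Fin m → Fin m → Fin m → ℤ × ℤ × ℤ → ℝ) (X : Fin m → ℤ → ℝ → ℝ) (i : Fin m) (n : ℤ) (t : ℝ)
    {M : ℝ} (hM : ∀ (j : Fin m) (k : ℤ), |X j k t| ≤ M) :
    |quadTerm ε₀ α X i n t| ≤
      2 * (∑ i₁, ∑ i₂, ∑ μ ∈ shiftSet, |α i₁ i₂ i μ|) * (1 + ε₀) ^ ((5 : ℝ) * n / 2) * M * M := by
  have h := abs_quadTerm_sub_quadTerm_le_of_le ε₀ hε α X (fun _ _ _ => (0 : ℝ)) i n t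
    (A := fun _ => M) (D := fun _ => M) (Amax := M) (Dmax := M) hM
    (fun j k => by simpa using (abs_nonneg (X j k t)).trans (hM j k))
    (fun j k => by simpa using hM j k) (fun _ _ _ => le_rfl) (fun _ _ _ => le_rfl)
  rwa [quadTerm_zero_family, sub_zero] at h

variable {τ ε₀ : ℝ} {α : Fin m → Fin m → Fin m → ℤ × ℤ × ℤ → ℝ} {κ₁ κ₂ κ₂' : ℝ}
  {S₀ F₀ B₀ S₀' F₀' B₀' : Fin m → ℤ → ℝ} {S F S' F' : Fin m → ℤ → ℝ → ℝ}

/-- **Uniform time-Lipschitz bound for the deviation.** Let `S` be a pseudo-flow with motion defect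
`κ₁ ≥ 0` and `S'` a defect-free flow on `[0, τ]` (`ε₀ ≥ 0`), with uniform bounds
`|S_{j,k}(u)|, |S'_{j,k}(u)|, √F_{j,k}(u) ≤ M` on `[0, τ]` (from (4.5), cf. `pseudoFlowOn_uniform_bounds`).
Then for every mode `i`, shell `n` and `s, t ∈ [0, τ]`:
`|(S − S')_{i,n}(t) − (S − S')_{i,n}(s)| ≤ (4 (∑|α_{··i·}|) (1+ε₀)^{5n/2} M² + κ₁ (1+ε₀)^{2n} M) |t − s|`.
[cite: Tao2016AveragedNS, §4 Lemma 4.1 (4.5), (4.8)] -/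
theorem pseudoFlowOn_sub_lipschitz (h : PseudoFlowOn τ ε₀ α κ₁ κ₂ S₀ F₀ B₀ S F)
    (h' : PseudoFlowOn τ ε₀ α 0 κ₂' S₀' F₀' B₀' S' F') (hε : 0 ≤ ε₀) (hκ₁ : 0 ≤ κ₁) {M : ℝ}
    (hM : ∀ u ∈ Icc 0 τ, ∀ (j : Fin m) (k : ℤ),
      |S j k u| ≤ M ∧ |S' j k u| ≤ M ∧ Real.sqrt (F j k u) ≤ M)
    (i : Fin m) (n : ℤ) {s t : ℝ} (hs : s ∈ Icc 0 τ) (ht : t ∈ Icc 0 τ) :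
    |(S i n t - S' i n t) - (S i n s - S' i n s)| ≤
      (4 * (∑ i₁, ∑ i₂, ∑ μ ∈ shiftSet, |α i₁ i₂ i μ|) * (1 + ε₀) ^ ((5 : ℝ) * n / 2) * M * M +
        κ₁ * (1 + ε₀) ^ ((2 : ℝ) * n) * M) * |t - s| := by
  have hq : 0 < 1 + ε₀ := by linarith
  set C : ℝ := ∑ i₁ : Fin m, ∑ i₂ : Fin m, ∑ μ ∈ shiftSet, |α i₁ i₂ i μ| with hC
  set Λ : ℝ := (1 + ε₀) ^ ((5 : ℝ) * n / 2) with hΛ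
  -- Lipschitz constants of the two flows at mode (i, n)
  have hLS : ∀ u ∈ Icc 0 τ, |quadTerm ε₀ α S i n u| +
      κ₁ * (1 + ε₀) ^ ((2 : ℝ) * n) * Real.sqrt (F i n u) ≤
      2 * C * Λ * M * M + κ₁ * (1 + ε₀) ^ ((2 : ℝ) * n) * M := by
    intro u hu
    have h1 := abs_quadTerm_le_of_uniform hε α S i n u (fun j k => (hM u hu j k).1)
    have h2 : κ₁ * (1 + ε₀) ^ ((2 : ℝ) * n) * Real.sqrt (F i n u) ≤
        κ₁ * (1 + ε₀) ^ ((2 : ℝ) * n) * M :=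
      mul_le_mul_of_nonneg_left (hM u hu i n).2.2 (mul_nonneg hκ₁ (Real.rpow_pos_of_pos hq _).le)
    simp only [hC, hΛ] at h1 ⊢
    linarith
  have hLS' : ∀ u ∈ Icc 0 τ, |quadTerm ε₀ α S' i n u| +
      0 * (1 + ε₀) ^ ((2 : ℝ) * n) * Real.sqrt (F' i n u) ≤ 2 * C * Λ * M * M := by
    intro u hu
    have h1 := abs_quadTerm_le_of_uniform hε α S' i n u (fun j k => (hM u hu j k).2.1)
    simp only [hC, hΛ] at h1 ⊢
    linarith
  have hS := pseudoFlowOn_abs_sub_le h i n hLS hs ht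
  have hS' := pseudoFlowOn_abs_sub_le h' i n hLS' hs ht
  have htri : |(S i n t - S' i n t) - (S i n s - S' i n s)| ≤
      |S i n t - S i n s| + |S' i n t - S' i n s| := by
    have := abs_sub (S i n t - S i n s) (S' i n t - S' i n s)
    have heq : (S i n t - S' i n t) - (S i n s - S' i n s) =
        (S i n t - S i n s) - (S' i n t - S' i n s) := by ring
    rw [heq]; exact this
  have habs : 0 ≤ |t - s| := abs_nonneg _
  calc |(S i n t - S' i n t) - (S i n s - S' i n s)|
      ≤ |S i n t - S i n s| + |S' i n t - S' i n s| := htri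
    _ ≤ (2 * C * Λ * M * M + κ₁ * (1 + ε₀) ^ ((2 : ℝ) * n) * M) * |t - s| +
          (2 * C * Λ * M * M) * |t - s| := add_le_add hS hS'
    _ = (4 * C * Λ * M * M + κ₁ * (1 + ε₀) ^ ((2 : ℝ) * n) * M) * |t - s| := by ring

/-! ### Qualitative Lipschitz bounds from `C¹` (appended by p1 g9; the `hlip` inputs of the block member) -/

/-- A `C¹` function on `[0, τ]` is Lipschitz there (its derivative within `[0, τ]` is continuous, hence
bounded on the compact interval; mean value inequality). [folklore] -/
theorem exists_lipschitz_of_contDiffOn_Icc {f : ℝ → ℝ} {τ : ℝ} (hτ : 0 < τ)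
    (hf : ContDiffOn ℝ 1 f (Icc 0 τ)) :
    ∃ L : ℝ, 0 ≤ L ∧ ∀ s ∈ Icc 0 τ, ∀ t ∈ Icc 0 τ, |f t - f s| ≤ L * |t - s| := by
  have hcont : ContinuousOn (derivWithin f (Icc 0 τ)) (Icc 0 τ) :=
    hf.continuousOn_derivWithin (uniqueDiffOn_Icc hτ) le_rfl
  obtain ⟨B, hB⟩ := isCompact_Icc.exists_bound_of_continuousOn hcont
  refine ⟨max B 0, le_max_right _ _, fun s hs t ht => ?_⟩
  have hdiff : DifferentiableOn ℝ f (Icc 0 τ) := hf.differentiableOn one_ne_zero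
  have hbound : ∀ x ∈ Icc 0 τ, ‖derivWithin f (Icc 0 τ) x‖ ≤ max B 0 :=
    fun x hx => (hB x hx).trans (le_max_left _ _)
  have := (convex_Icc 0 τ).norm_image_sub_le_of_norm_derivWithin_le hdiff hbound hs ht
  simpa only [Real.norm_eq_abs] using this

/-- **The block energy of a pseudo-flow is Lipschitz in time** (qualitatively; finite sums of `C¹`
energies): for every block `K, …, K+Lb−1` there is `L ≥ 0` with
`|∑_{block}∑_i F(t) − ∑_{block}∑_i F(s)| ≤ L |t − s|` on `[0, τ]`.
[cite: Tao2016AveragedNS, §4 Lemma 4.1 (i) (continuously differentiable energies)] -/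
theorem pseudoFlowOn_block_energy_lipschitz (h : PseudoFlowOn τ ε₀ α κ₁ κ₂ S₀ F₀ B₀ S F) (hτ : 0 < τ)
    (K : ℤ) (Lb : ℕ) :
    ∃ L : ℝ, 0 ≤ L ∧ ∀ s ∈ Icc 0 τ, ∀ t ∈ Icc 0 τ,
      |∑ k ∈ Finset.range Lb, ∑ i, F i (K + k) t - ∑ k ∈ Finset.range Lb, ∑ i, F i (K + k) s| ≤
        L * |t - s| := by
  have hcd : ContDiffOn ℝ 1 (fun t => ∑ k ∈ Finset.range Lb, ∑ i, F i (K + k) t) (Icc 0 τ) :=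
    ContDiffOn.sum fun k _ => ContDiffOn.sum fun i _ => h.contDiffOn_F i (K + k)
  exact exists_lipschitz_of_contDiffOn_Icc hτ hcd

/-- **Each amplitude of a pseudo-flow is Lipschitz in time** (qualitatively, one shell at a time).
[cite: Tao2016AveragedNS, §4 Lemma 4.1 (i) (continuously differentiable amplitudes)] -/
theorem pseudoFlowOn_amplitude_lipschitz (h : PseudoFlowOn τ ε₀ α κ₁ κ₂ S₀ F₀ B₀ S F) (hτ : 0 < τ)
    (i : Fin m) (k : ℤ) :
    ∃ L : ℝ, 0 ≤ L ∧ ∀ s ∈ Icc 0 τ, ∀ t ∈ Icc 0 τ, |S i k t - S i k s| ≤ L * |t - s| :=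
  exists_lipschitz_of_contDiffOn_Icc hτ (h.contDiffOn_S i k)

end GappedFrontRobust

end Summit.NavierStokesRegularity.NavierStokesRegularity.Theorems

end
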